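import Summits.FinalStateConjecture.FinalStateConjecture.Theorems.EIHFluxBalanceInertialRecessionVirialPerSet
import Summits.FinalStateConjecture.FinalStateConjecture.Theorems.EIHFluxBalanceInertialRecessionVirialGain
import Summits.FinalStateConjecture.FinalStateConjecture.Theorems.EIHFluxBalanceInertialRecessionVirialFamilyProps

/-!
# Route EIHFluxBalance — crux `InertialRecession`, abstract endgame for general `N`:
# the frozen-block virial inequality (digested hypotheses)

Helper file for the crux `stmt-FinalStateConjecture-10166` (virial route; `InertialRecession_seat0_session8_note.md` §A).
Mathlib-only. From the digested node law, the grid constants, the cone, the distance floor `2^{k₀+1} ≤ r_min`, speed `≤ 1`,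
a `1`-gapped root and the envelopes: over `n` fine steps `tᵢ = T + i h`,

  `G(tₙ) − G(t₀) ≥ (2M_𝒦)⁻¹ ∫_{t₀}^{tₙ} σ₂ − Σᵢ h ε_a(t_{i+1}) − 2^{|𝒦|} (Σᵢ h ε_b(t_{i+1}) + J(D_n))`

(`frozen_block_virial`): the identity `virial_sum_identity_lt` (restricted to `i < n`) over the families of the frozen-block
hierarchy (`family_laminar`, `singleton_mem_family`, `exists_parentOf`), the gain `steps_gain_lower_bound`, and `perSet_cost_le`
summed over the subsets of the root.
-/

noncomputable section

open Finset MeasureTheory intervalIntegral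

namespace Summit.FinalStateConjecture.FinalStateConjecture.Theorems.SublinearIsFree.Virial

open Literature.Geometry.Lorentzian

variable {N : ℕ}

/-- **Virial sum identity, hypotheses restricted to the steps `i < n`.** As `virial_sum_identity`. [folklore] -/
theorem virial_sum_identity_lt {ι : Type*} [DecidableEq ι] (𝒦 : Finset ι) (M : ι → ℝ) (hM : ∀ i, 0 < M i) (p ξ : ι → ℕ → E3)
    (F : ℕ → Finset (Finset ι)) (par : ℕ → Finset ι → Finset ι) (n : ℕ)
    (hF : ∀ i < n, ∀ A ∈ F i, A ⊂ 𝒦) (hp₁ : ∀ i < n, ∀ A ∈ F i, A ⊂ par i A)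
    (hp₂ : ∀ i < n, ∀ A ∈ F i, par i A ∈ F i ∨ par i A = 𝒦)
    (hp₃ : ∀ i < n, ∀ A ∈ F i, ∀ B, (B ∈ F i ∨ B = 𝒦) → A ⊂ B → par i A ⊆ B)
    (hsing : ∀ i < n, ∀ j ∈ 𝒦, ({j} : Finset ι) ∈ F i) (h𝒦 : 2 ≤ 𝒦.card) :
    (∑ j ∈ 𝒦, inner ℝ (p j n) (ξ j n - (∑ k ∈ 𝒦, M k)⁻¹ • ∑ k ∈ 𝒦, M k • ξ k n)) -
      ∑ j ∈ 𝒦, inner ℝ (p j 0) (ξ j 0 - (∑ k ∈ 𝒦, M k)⁻¹ • ∑ k ∈ 𝒦, M k • ξ k 0) =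
    (∑ i ∈ range n, ∑ j ∈ 𝒦, inner ℝ (p j i) ((ξ j (i + 1) - ξ j i) -
        ((∑ k ∈ 𝒦, M k)⁻¹ • ∑ k ∈ 𝒦, M k • ξ k (i + 1) - (∑ k ∈ 𝒦, M k)⁻¹ • ∑ k ∈ 𝒦, M k • ξ k i))) +
    ∑ B ∈ 𝒦.powerset, ∑ i ∈ (range n).filter (fun i ↦ B ∈ F i),
      inner ℝ (∑ j ∈ B, p j (i + 1) - ∑ j ∈ B, p j i)
        ((∑ k ∈ B, M k)⁻¹ • ∑ k ∈ B, M k • ξ k (i + 1) -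
          (∑ k ∈ par i B, M k)⁻¹ • ∑ k ∈ par i B, M k • ξ k (i + 1)) := by
  classical
  -- replace the families beyond `n` by the singletons (they do not contribute)
  set F' : ℕ → Finset (Finset ι) := fun i ↦ if i < n then F i else 𝒦.image fun j ↦ ({j} : Finset ι) with hF'
  set par' : ℕ → Finset ι → Finset ι := fun i A ↦ if i < n then par i A else 𝒦 with hpar'
  have hss : ∀ j ∈ 𝒦, ({j} : Finset ι) ⊂ 𝒦 := by
    intro j hj
    refine Finset.ssubset_iff_subset_ne.mpr ⟨Finset.singleton_subset_iff.mpr hj, fun heq ↦ ?_⟩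
    have : 𝒦.card = 1 := by rw [← heq, Finset.card_singleton]
    omega
  have hF'i : ∀ i, n ≤ i → ∀ A, A ∈ F' i ↔ ∃ j ∈ 𝒦, ({j} : Finset ι) = A := fun i hi A ↦ by
    simp only [hF', if_neg (not_lt.mpr hi), Finset.mem_image]
  have key := virial_sum_identity 𝒦 M hM p ξ F' par' ?_ ?_ ?_ ?_ ?_ n
  · have hFi : ∀ i ∈ range n, F' i = F i := fun i hi ↦ by simp only [hF', if_pos (Finset.mem_range.mp hi)]
    have hpari : ∀ i ∈ range n, par' i = par i := fun i hi ↦ by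
      funext A; simp only [hpar', if_pos (Finset.mem_range.mp hi)]
    rw [key]
    congr 1
    refine Finset.sum_congr rfl fun B _ ↦ ?_
    have hfilt : (range n).filter (fun i ↦ B ∈ F' i) = (range n).filter (fun i ↦ B ∈ F i) :=
      Finset.filter_congr fun i hi ↦ by rw [hFi i hi]
    rw [hfilt]
    refine Finset.sum_congr rfl fun i hi ↦ ?_
    rw [hpari i (Finset.mem_filter.mp hi).1]
  · intro i A hA
    by_cases hi : i < n
    · simp only [hF', if_pos hi] at hA; exact hF i hi A hA
    · obtain ⟨j, hj, rfl⟩ := (hF'i i (not_lt.mp hi) A).mp hA; exact hss j hj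
  · intro i A hA
    by_cases hi : i < n
    · simp only [hF', if_pos hi] at hA; simp only [hpar', if_pos hi]; exact hp₁ i hi A hA
    · obtain ⟨j, hj, rfl⟩ := (hF'i i (not_lt.mp hi) A).mp hA
      simp only [hpar', if_neg hi]; exact hss j hj
  · intro i A hA
    by_cases hi : i < n
    · simp only [hF', if_pos hi] at hA ⊢; simp only [hpar', if_pos hi]; exact hp₂ i hi A hA
    · right; simp only [hpar', if_neg hi]
  · intro i A hA B hB hAB
    by_cases hi : i < n
    · simp only [hF', if_pos hi] at hA hB; simp only [hpar', if_pos hi]; exact hp₃ i hi A hA B hB hAB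
    · simp only [hpar', if_neg hi]
      rcases hB with hB | rfl
      · obtain ⟨j, hj, rfl⟩ := (hF'i i (not_lt.mp hi) A).mp hA
        obtain ⟨j', hj', rfl⟩ := (hF'i i (not_lt.mp hi) B).mp hB
        exfalso
        have h1 := Finset.card_lt_card hAB
        simp at h1
      · exact Finset.Subset.refl _
  · intro i j hj
    by_cases hi : i < n
    · simp only [hF', if_pos hi]; exact hsing i hi j hj
    · exact (hF'i i (not_lt.mp hi) _).mpr ⟨j, hj, rfl⟩


/-- **The frozen-block virial inequality (digested hypotheses).** See the module docstring. [folklore] -/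
theorem frozen_block_virial (ξ v : Fin N → ℝ → E3) (M : Fin N → ℝ) (𝒦 : Finset (Fin N))
    {κ δ C c₀ Λ h T TL k : ℝ} {k₀ n : ℕ} (ζ rmin Fζ FΦ Fe : ℝ → ℝ)
    (hNode : ∀ (t R : ℝ) (c : E3) (A : Finset (Fin N)), TL ≤ t → 0 < R → R ≤ c₀ * t →
      min (rmin t / (2 * (1 + 3 * δ))) (c₀ * t) ≤ R → ‖c‖ ≤ κ ^ 2 * t →
      (∀ j ∈ A, ‖ξ j t - c‖ ≤ (1 - 2 * δ) * R) → (∀ j ∉ A, (1 + 2 * δ) * R ≤ ‖ξ j t - c‖) →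
      ∀ s' ∈ Set.Icc t (t + δ * R),
        ‖∑ j ∈ A, (M j * (√(1 - ‖v j s'‖ ^ 2))⁻¹) • v j s' - ∑ j ∈ A, (M j * (√(1 - ‖v j t‖ ^ 2))⁻¹) • v j t‖ ≤
          3 * (C * ((s' - t) * (R ^ (3 / 2 : ℝ))⁻¹) + ζ t + ζ s'))
    (hC : 0 ≤ C) (hδ : 0 < δ) (hδ1 : δ ≤ 1 / 10) (hΛ : 32 ≤ Λ) (hΛκ : 2 * κ ^ 2 ≤ Λ * ((1 - 2 * δ) * c₀)) (hc₀ : 0 < c₀)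
    (hc₀1 : c₀ ≤ 1) (hh : 0 < h) (hT : 0 < T) (hTL : TL ≤ T) (hhT : h ≤ T)
    (hδ₁a : h / 2 ^ k₀ ≤ δ / (1 + 3 * δ)) (hδ₁b : h / 2 ^ k₀ * (2 * κ ^ 2) ≤ δ * c₀) (hδ₁c : h / 2 ^ k₀ ≤ 1 / 16)
    (hδ₁d : h / 2 ^ k₀ * (Λ + 1) ≤ 1 / 4)
    (hcone : ∀ (m : ℕ) (x : Fin N), ‖ξ x (T + m * h)‖ ≤ κ ^ 2 * (T + m * h))
    (hrmin : ∀ (m : ℕ) (x y : Fin N), x ≠ y → rmin (T + m * h) ≤ ‖ξ x (T + m * h) - ξ y (T + m * h)‖)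
    (hrmin0 : ∀ m : ℕ, 0 < rmin (T + m * h)) (hk₀r : ∀ m : ℕ, (2 : ℝ) ^ (k₀ + 1) ≤ rmin (T + m * h))
    (hmove : ∀ x (m m' : ℕ), m ≤ m' → ‖ξ x (T + m' * h) - ξ x (T + m * h)‖ ≤ (m' - m) * h)
    (hroot : ∀ m ≤ n, ∃ D G : ℝ, (∀ x ∈ 𝒦, ∀ y ∈ 𝒦, ‖ξ x (T + m * h) - ξ y (T + m * h)‖ ≤ D) ∧
      (∀ x ∈ 𝒦, ∀ z ∈ univ \ 𝒦, G ≤ ‖ξ x (T + m * h) - ξ z (T + m * h)‖) ∧ 1 * D < G)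
    (hFζ : ∀ s t : ℝ, T ≤ s → t / 2 ≤ s → ζ s ≤ Fζ t)
    (hFΦ : ∀ (m : ℕ) (t : ℝ), t / 2 ≤ T + m * h →
      (((1 + 3 * δ)⁻¹) ^ (3 / 2 : ℝ))⁻¹ * √2 * (√(rmin (T + m * h)))⁻¹ + 2 * κ ^ 2 * (c₀ ^ (3 / 2 : ℝ))⁻¹ * (√(T + m * h))⁻¹ ≤ FΦ t)
    (hFe : ∀ s t : ℝ, T ≤ s → t / 2 ≤ s → ∀ j, ‖deriv (ξ j) s - v j s‖ ≤ Fe t) (hFe1 : ∀ t, Fe t ≤ 1)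
    (hFζ0 : ∀ t, 0 ≤ Fζ t) (hFζ1 : ∀ t, Fζ t ≤ 1) (hFΦ0 : ∀ t, 0 ≤ FΦ t) (hFΦ1 : ∀ t, FΦ t ≤ 1)
    (hFζa : Antitone Fζ) (hFΦa : Antitone FΦ)
    (hM : ∀ i, 0 < M i) (hk : k < 1) (hvk : ∀ i t, ‖v i t‖ ≤ k) (hvc : ∀ i, Continuous (v i))
    (hξ : ∀ i, ContDiff ℝ ((⊤ : ℕ∞) : WithTop ℕ∞) (ξ i)) (h𝒦 : 2 ≤ 𝒦.card)
    {Dn : ℝ} (hDn0 : 0 ≤ Dn) (hDn : ∀ x ∈ 𝒦, ∀ y ∈ 𝒦, ‖ξ x (T + n * h) - ξ y (T + n * h)‖ ≤ Dn) :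
    (2 * ∑ i ∈ 𝒦, M i)⁻¹ * (∫ s in T..(T + n * h), ∑ j ∈ 𝒦, ∑ l ∈ 𝒦, M j * M l * ‖v j s - v l s‖ ^ 2) -
        ∑ i ∈ range n, h * (2 * (√(1 - k ^ 2))⁻¹ * (∑ i ∈ 𝒦, M i) * Fe (T + (i + 1 : ℕ) * h) +
          4 * 𝒦.card * (3 * (C * (h / 2 ^ k₀) * FΦ (T + (i + 1 : ℕ) * h) + 2 * Fζ (T + (i + 1 : ℕ) * h)))) -
        2 ^ 𝒦.card * (∑ i ∈ range n, h * (3 * (96 * (4 * Λ + 2) ^ N + 2 * (h / 2 ^ k₀)) *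
          (C * FΦ (T + (i + 1 : ℕ) * h) + 2 * Fζ (T + (i + 1 : ℕ) * h) / (h / 2 ^ k₀))) +
          3 * (96 * (4 * Λ + 2) ^ N + 2 * (h / 2 ^ k₀)) * (C * (h / 2 ^ k₀) + 2) * (2 * Dn)) ≤
      (∑ j ∈ 𝒦, inner ℝ ((M j * (√(1 - ‖v j (T + n * h)‖ ^ 2))⁻¹) • v j (T + n * h))
        (ξ j (T + n * h) - (∑ l ∈ 𝒦, M l)⁻¹ • ∑ l ∈ 𝒦, M l • ξ l (T + n * h))) -
      (∑ j ∈ 𝒦, inner ℝ ((M j * (√(1 - ‖v j (T)‖ ^ 2))⁻¹) • v j (T))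
        (ξ j (T) - (∑ l ∈ 𝒦, M l)⁻¹ • ∑ l ∈ 𝒦, M l • ξ l (T))) := by
  classical
  have hh0 : 0 ≤ h := hh.le
  have hΛ2 : (2 : ℝ) ≤ Λ := by linarith
  have hk₀r' : ∀ m : ℕ, (2 : ℝ) ^ k₀ ≤ rmin (T + m * h) := fun m ↦
    le_trans (pow_le_pow_right₀ (by norm_num) (Nat.le_succ k₀)) (hk₀r m)
  obtain ⟨j₁, hj₁, j₂, hj₂, hj12⟩ : ∃ j₁ ∈ 𝒦, ∃ j₂ ∈ 𝒦, j₁ ≠ j₂ := Finset.one_lt_card.mp h𝒦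
  have h𝒦ne : 𝒦.Nonempty := ⟨j₁, hj₁⟩
  have hN : (univ : Finset (Fin N)).Nontrivial := ⟨j₁, Finset.mem_univ _, j₂, Finset.mem_univ _, hj12⟩
  -- a level bound `L`
  obtain ⟨L, hL2⟩ := pow_unbounded_of_one_lt (2 * κ ^ 2 * (T + n * h)) (by norm_num : (1 : ℝ) < 2)
  have hL : ∀ i ≤ n, ∀ x y : Fin N, ‖ξ x (T + i * h) - ξ y (T + i * h)‖ < (2 : ℝ) ^ L := by
    intro i hi x y
    have h1 := hcone i x; have h2 := hcone i y
    have h3 : T + (i : ℝ) * h ≤ T + n * h := by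
      have : (i : ℝ) ≤ n := by exact_mod_cast hi
      nlinarith
    have hκ : 0 ≤ κ ^ 2 := sq_nonneg κ
    calc ‖ξ x (T + i * h) - ξ y (T + i * h)‖ ≤ ‖ξ x (T + i * h)‖ + ‖ξ y (T + i * h)‖ := norm_sub_le _ _
      _ ≤ 2 * κ ^ 2 * (T + n * h) := by nlinarith
      _ < 2 ^ L := hL2
  -- grid facts
  have hhk16 : ∀ ℓ, k₀ ≤ ℓ → (2 : ℝ) ^ (ℓ - k₀) * h ≤ (2 : ℝ) ^ ℓ / 16 := by
    intro ℓ hk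
    obtain ⟨e', rfl⟩ := Nat.exists_eq_add_of_le hk
    rw [Nat.add_sub_cancel_left, pow_add]
    have : (2 : ℝ) ^ e' * h = 2 ^ k₀ * 2 ^ e' * (h / 2 ^ k₀) := by field_simp
    rw [this]
    have := mul_le_mul_of_nonneg_left hδ₁c (by positivity : (0 : ℝ) ≤ 2 ^ k₀ * 2 ^ e')
    linarith
  have hrmin2 : ∀ i ≤ n, ∀ x y : Fin N, x ≠ y → (2 : ℝ) ^ (k₀ + 1) ≤ ‖ξ x (T + i * h) - ξ y (T + i * h)‖ :=
    fun i _ x y hxy ↦ (hk₀r i).trans (hrmin i x y hxy)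
  -- the family of step `i`
  set F : ℕ → Finset (Finset (Fin N)) := fun i ↦ 𝒦.powerset.filter (fun B ↦ B ⊂ 𝒦 ∧ B.Nonempty ∧ ∃ ℓ : ℕ, k₀ ≤ ℓ ∧ ℓ < L ∧
    ∃ D g : ℝ,
      (∀ x ∈ B, ∀ y ∈ B, ‖ξ x (T + (2 ^ (ℓ - k₀) * (i / 2 ^ (ℓ - k₀)) : ℕ) * h) - ξ y (T + (2 ^ (ℓ - k₀) * (i / 2 ^ (ℓ - k₀)) : ℕ) * h)‖ ≤ D) ∧
      (∀ x ∈ B, ∀ z ∈ univ \ B, g ≤ ‖ξ x (T + (2 ^ (ℓ - k₀) * (i / 2 ^ (ℓ - k₀)) : ℕ) * h) - ξ z (T + (2 ^ (ℓ - k₀) * (i / 2 ^ (ℓ - k₀)) : ℕ) * h)‖) ∧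
      (∃ x₀ ∈ B, ∃ z₀ ∈ univ \ B, ‖ξ x₀ (T + (2 ^ (ℓ - k₀) * (i / 2 ^ (ℓ - k₀)) : ℕ) * h) - ξ z₀ (T + (2 ^ (ℓ - k₀) * (i / 2 ^ (ℓ - k₀)) : ℕ) * h)‖ < 2 * g) ∧
      Λ * D < g ∧ (2 : ℝ) ^ ℓ ≤ g ∧ g < (2 : ℝ) ^ (ℓ + 3)) with hF
  have hFdef : ∀ i B, B ∈ F i ↔ B ⊂ 𝒦 ∧ B.Nonempty ∧ ∃ ℓ : ℕ, k₀ ≤ ℓ ∧ ℓ < L ∧ ∃ D g : ℝ,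
      (∀ x ∈ B, ∀ y ∈ B, ‖ξ x (T + (2 ^ (ℓ - k₀) * (i / 2 ^ (ℓ - k₀)) : ℕ) * h) - ξ y (T + (2 ^ (ℓ - k₀) * (i / 2 ^ (ℓ - k₀)) : ℕ) * h)‖ ≤ D) ∧
      (∀ x ∈ B, ∀ z ∈ univ \ B, g ≤ ‖ξ x (T + (2 ^ (ℓ - k₀) * (i / 2 ^ (ℓ - k₀)) : ℕ) * h) - ξ z (T + (2 ^ (ℓ - k₀) * (i / 2 ^ (ℓ - k₀)) : ℕ) * h)‖) ∧
      (∃ x₀ ∈ B, ∃ z₀ ∈ univ \ B, ‖ξ x₀ (T + (2 ^ (ℓ - k₀) * (i / 2 ^ (ℓ - k₀)) : ℕ) * h) - ξ z₀ (T + (2 ^ (ℓ - k₀) * (i / 2 ^ (ℓ - k₀)) : ℕ) * h)‖ < 2 * g) ∧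
      Λ * D < g ∧ (2 : ℝ) ^ ℓ ≤ g ∧ g < (2 : ℝ) ^ (ℓ + 3) := by
    intro i B
    simp only [hF, Finset.mem_filter, Finset.mem_powerset]
    exact ⟨fun h ↦ h.2, fun h ↦ ⟨h.1.1, h⟩⟩
  -- the level of a node
  set lev : ℕ → Finset (Fin N) → ℕ := fun i B ↦
    if hS : ((range L).filter (fun ℓ ↦ k₀ ≤ ℓ ∧ ∃ D g : ℝ,
      (∀ x ∈ B, ∀ y ∈ B, ‖ξ x (T + (2 ^ (ℓ - k₀) * (i / 2 ^ (ℓ - k₀)) : ℕ) * h) - ξ y (T + (2 ^ (ℓ - k₀) * (i / 2 ^ (ℓ - k₀)) : ℕ) * h)‖ ≤ D) ∧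
      (∀ x ∈ B, ∀ z ∈ univ \ B, g ≤ ‖ξ x (T + (2 ^ (ℓ - k₀) * (i / 2 ^ (ℓ - k₀)) : ℕ) * h) - ξ z (T + (2 ^ (ℓ - k₀) * (i / 2 ^ (ℓ - k₀)) : ℕ) * h)‖) ∧
      (∃ x₀ ∈ B, ∃ z₀ ∈ univ \ B, ‖ξ x₀ (T + (2 ^ (ℓ - k₀) * (i / 2 ^ (ℓ - k₀)) : ℕ) * h) - ξ z₀ (T + (2 ^ (ℓ - k₀) * (i / 2 ^ (ℓ - k₀)) : ℕ) * h)‖ < 2 * g) ∧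
      Λ * D < g ∧ (2 : ℝ) ^ ℓ ≤ g ∧ g < (2 : ℝ) ^ (ℓ + 3))).Nonempty then
      ((range L).filter (fun ℓ ↦ k₀ ≤ ℓ ∧ ∃ D g : ℝ,
      (∀ x ∈ B, ∀ y ∈ B, ‖ξ x (T + (2 ^ (ℓ - k₀) * (i / 2 ^ (ℓ - k₀)) : ℕ) * h) - ξ y (T + (2 ^ (ℓ - k₀) * (i / 2 ^ (ℓ - k₀)) : ℕ) * h)‖ ≤ D) ∧
      (∀ x ∈ B, ∀ z ∈ univ \ B, g ≤ ‖ξ x (T + (2 ^ (ℓ - k₀) * (i / 2 ^ (ℓ - k₀)) : ℕ) * h) - ξ z (T + (2 ^ (ℓ - k₀) * (i / 2 ^ (ℓ - k₀)) : ℕ) * h)‖) ∧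
      (∃ x₀ ∈ B, ∃ z₀ ∈ univ \ B, ‖ξ x₀ (T + (2 ^ (ℓ - k₀) * (i / 2 ^ (ℓ - k₀)) : ℕ) * h) - ξ z₀ (T + (2 ^ (ℓ - k₀) * (i / 2 ^ (ℓ - k₀)) : ℕ) * h)‖ < 2 * g) ∧
      Λ * D < g ∧ (2 : ℝ) ^ ℓ ≤ g ∧ g < (2 : ℝ) ^ (ℓ + 3))).max' hS else 0 with hlevdef
  have hlevmem : ∀ i B, B ∈ F i → lev i B ∈ (range L).filter (fun ℓ ↦ k₀ ≤ ℓ ∧ ∃ D g : ℝ,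
      (∀ x ∈ B, ∀ y ∈ B, ‖ξ x (T + (2 ^ (ℓ - k₀) * (i / 2 ^ (ℓ - k₀)) : ℕ) * h) - ξ y (T + (2 ^ (ℓ - k₀) * (i / 2 ^ (ℓ - k₀)) : ℕ) * h)‖ ≤ D) ∧
      (∀ x ∈ B, ∀ z ∈ univ \ B, g ≤ ‖ξ x (T + (2 ^ (ℓ - k₀) * (i / 2 ^ (ℓ - k₀)) : ℕ) * h) - ξ z (T + (2 ^ (ℓ - k₀) * (i / 2 ^ (ℓ - k₀)) : ℕ) * h)‖) ∧
      (∃ x₀ ∈ B, ∃ z₀ ∈ univ \ B, ‖ξ x₀ (T + (2 ^ (ℓ - k₀) * (i / 2 ^ (ℓ - k₀)) : ℕ) * h) - ξ z₀ (T + (2 ^ (ℓ - k₀) * (i / 2 ^ (ℓ - k₀)) : ℕ) * h)‖ < 2 * g) ∧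
      Λ * D < g ∧ (2 : ℝ) ^ ℓ ≤ g ∧ g < (2 : ℝ) ^ (ℓ + 3)) := by
    intro i B hB
    obtain ⟨-, -, ℓ, hk, hℓL, hQ⟩ := (hFdef i B).mp hB
    have hS : ((range L).filter (fun ℓ ↦ k₀ ≤ ℓ ∧ ∃ D g : ℝ,
      (∀ x ∈ B, ∀ y ∈ B, ‖ξ x (T + (2 ^ (ℓ - k₀) * (i / 2 ^ (ℓ - k₀)) : ℕ) * h) - ξ y (T + (2 ^ (ℓ - k₀) * (i / 2 ^ (ℓ - k₀)) : ℕ) * h)‖ ≤ D) ∧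
      (∀ x ∈ B, ∀ z ∈ univ \ B, g ≤ ‖ξ x (T + (2 ^ (ℓ - k₀) * (i / 2 ^ (ℓ - k₀)) : ℕ) * h) - ξ z (T + (2 ^ (ℓ - k₀) * (i / 2 ^ (ℓ - k₀)) : ℕ) * h)‖) ∧
      (∃ x₀ ∈ B, ∃ z₀ ∈ univ \ B, ‖ξ x₀ (T + (2 ^ (ℓ - k₀) * (i / 2 ^ (ℓ - k₀)) : ℕ) * h) - ξ z₀ (T + (2 ^ (ℓ - k₀) * (i / 2 ^ (ℓ - k₀)) : ℕ) * h)‖ < 2 * g) ∧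
      Λ * D < g ∧ (2 : ℝ) ^ ℓ ≤ g ∧ g < (2 : ℝ) ^ (ℓ + 3))).Nonempty :=
      ⟨ℓ, Finset.mem_filter.mpr ⟨Finset.mem_range.mpr hℓL, hk, hQ⟩⟩
    simp only [hlevdef, dif_pos hS]
    exact Finset.max'_mem _ _
  have hlev : ∀ i, ∀ B ∈ F i, k₀ ≤ lev i B ∧ lev i B < L ∧
      ∃ D g : ℝ,
      (∀ x ∈ B, ∀ y ∈ B, ‖ξ x (T + (2 ^ (lev i B - k₀) * (i / 2 ^ (lev i B - k₀)) : ℕ) * h) -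
        ξ y (T + (2 ^ (lev i B - k₀) * (i / 2 ^ (lev i B - k₀)) : ℕ) * h)‖ ≤ D) ∧
      (∀ x ∈ B, ∀ z ∈ univ \ B, g ≤ ‖ξ x (T + (2 ^ (lev i B - k₀) * (i / 2 ^ (lev i B - k₀)) : ℕ) * h) -
        ξ z (T + (2 ^ (lev i B - k₀) * (i / 2 ^ (lev i B - k₀)) : ℕ) * h)‖) ∧
      (∃ x₀ ∈ B, ∃ z₀ ∈ univ \ B, ‖ξ x₀ (T + (2 ^ (lev i B - k₀) * (i / 2 ^ (lev i B - k₀)) : ℕ) * h) -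
        ξ z₀ (T + (2 ^ (lev i B - k₀) * (i / 2 ^ (lev i B - k₀)) : ℕ) * h)‖ < 2 * g) ∧
      Λ * D < g ∧ (2 : ℝ) ^ (lev i B) ≤ g ∧ g < (2 : ℝ) ^ ((lev i B) + 3) := by
    intro i B hB
    have h := Finset.mem_filter.mp (hlevmem i B hB)
    exact ⟨h.2.1, Finset.mem_range.mp h.1, h.2.2⟩
  have hlevmax : ∀ i, ∀ B ∈ F i, ∀ ℓ, k₀ ≤ ℓ → ℓ < L → (∃ D g : ℝ,
      (∀ x ∈ B, ∀ y ∈ B, ‖ξ x (T + (2 ^ (ℓ - k₀) * (i / 2 ^ (ℓ - k₀)) : ℕ) * h) - ξ y (T + (2 ^ (ℓ - k₀) * (i / 2 ^ (ℓ - k₀)) : ℕ) * h)‖ ≤ D) ∧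
      (∀ x ∈ B, ∀ z ∈ univ \ B, g ≤ ‖ξ x (T + (2 ^ (ℓ - k₀) * (i / 2 ^ (ℓ - k₀)) : ℕ) * h) - ξ z (T + (2 ^ (ℓ - k₀) * (i / 2 ^ (ℓ - k₀)) : ℕ) * h)‖) ∧
      (∃ x₀ ∈ B, ∃ z₀ ∈ univ \ B, ‖ξ x₀ (T + (2 ^ (ℓ - k₀) * (i / 2 ^ (ℓ - k₀)) : ℕ) * h) - ξ z₀ (T + (2 ^ (ℓ - k₀) * (i / 2 ^ (ℓ - k₀)) : ℕ) * h)‖ < 2 * g) ∧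
      Λ * D < g ∧ (2 : ℝ) ^ ℓ ≤ g ∧ g < (2 : ℝ) ^ (ℓ + 3)) → ℓ ≤ lev i B := by
    intro i B hB ℓ hk hℓL hQ
    have hS : ((range L).filter (fun ℓ ↦ k₀ ≤ ℓ ∧ ∃ D g : ℝ,
      (∀ x ∈ B, ∀ y ∈ B, ‖ξ x (T + (2 ^ (ℓ - k₀) * (i / 2 ^ (ℓ - k₀)) : ℕ) * h) - ξ y (T + (2 ^ (ℓ - k₀) * (i / 2 ^ (ℓ - k₀)) : ℕ) * h)‖ ≤ D) ∧
      (∀ x ∈ B, ∀ z ∈ univ \ B, g ≤ ‖ξ x (T + (2 ^ (ℓ - k₀) * (i / 2 ^ (ℓ - k₀)) : ℕ) * h) - ξ z (T + (2 ^ (ℓ - k₀) * (i / 2 ^ (ℓ - k₀)) : ℕ) * h)‖) ∧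
      (∃ x₀ ∈ B, ∃ z₀ ∈ univ \ B, ‖ξ x₀ (T + (2 ^ (ℓ - k₀) * (i / 2 ^ (ℓ - k₀)) : ℕ) * h) - ξ z₀ (T + (2 ^ (ℓ - k₀) * (i / 2 ^ (ℓ - k₀)) : ℕ) * h)‖ < 2 * g) ∧
      Λ * D < g ∧ (2 : ℝ) ^ ℓ ≤ g ∧ g < (2 : ℝ) ^ (ℓ + 3))).Nonempty :=
      ⟨ℓ, Finset.mem_filter.mpr ⟨Finset.mem_range.mpr hℓL, hk, hQ⟩⟩
    simp only [hlevdef, dif_pos hS]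
    exact Finset.le_max' _ _ (Finset.mem_filter.mpr ⟨Finset.mem_range.mpr hℓL, hk, hQ⟩)
  -- parents, laminarity, singletons
  obtain ⟨parOf, hpar, hparOf⟩ := exists_parentOf (ι := Fin N) 𝒦
  have hlam : ∀ i, ∀ A ∈ F i, ∀ B ∈ F i, (A ∩ B).Nonempty → A ⊆ B ∨ B ⊆ A :=
    family_laminar ξ 𝒦 F hFdef hΛ hh0 hhk16 hmove
  have hFne : ∀ i, ∀ A ∈ F i, A.Nonempty := fun i A hA ↦ ((hFdef i A).mp hA).2.1
  have hFss : ∀ i, ∀ A ∈ F i, A ⊂ 𝒦 := fun i A hA ↦ ((hFdef i A).mp hA).1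
  have hp₁ : ∀ i, ∀ A ∈ F i, A ⊂ parOf (F i) A := fun i ↦ (hpar (F i) (hlam i) (hFne i) (hFss i)).1
  have hp₂ : ∀ i, ∀ A ∈ F i, parOf (F i) A ∈ F i ∨ parOf (F i) A = 𝒦 := fun i ↦ (hpar (F i) (hlam i) (hFne i) (hFss i)).2.1
  have hp₃ : ∀ i, ∀ A ∈ F i, ∀ B, (B ∈ F i ∨ B = 𝒦) → A ⊂ B → parOf (F i) A ⊆ B := fun i ↦
    (hpar (F i) (hlam i) (hFne i) (hFss i)).2.2
  have hsing : ∀ i ≤ n, ∀ j ∈ 𝒦, ({j} : Finset (Fin N)) ∈ F i := fun i hi j hj ↦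
    singleton_mem_family ξ 𝒦 F hFdef hh0 hhk16 hmove h𝒦 hrmin2 hL hi hj
  -- the identity
  have hid := virial_sum_identity_lt 𝒦 M hM (fun j i ↦ (M j * (√(1 - ‖v j (T + i * h)‖ ^ 2))⁻¹) • v j (T + i * h))
    (fun j i ↦ ξ j (T + i * h)) F (fun i ↦ parOf (F i)) n (fun i _ ↦ hFss i) (fun i _ ↦ hp₁ i) (fun i _ ↦ hp₂ i)
    (fun i _ ↦ hp₃ i) (fun i hi ↦ hsing i hi.le) h𝒦
  simp only [Nat.cast_zero, zero_mul, add_zero] at hid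
  -- the gain
  have hgain := steps_gain_lower_bound ξ v M 𝒦 ζ rmin Fζ FΦ Fe hNode hC hδ hδ1 hΛ2 hΛκ hc₀ hh0 hT hTL hhT hδ₁a hδ₁b hcone hrmin
    hrmin0 hk₀r' hFζ hFΦ hFe hFe1 hN hM hk hvk hvc hξ h𝒦ne n
  -- the per-set costs
  have hper := fun B (_ : B ∈ 𝒦.powerset) ↦ perSet_cost_le ξ v M 𝒦 hM ζ rmin Fζ FΦ F lev parOf hFdef hlev hlevmax hparOf hp₁ hp₂ hp₃
    hNode hC hδ hδ1 hΛ hΛκ hc₀ hh0 hT hTL hδ₁a hδ₁b hδ₁c hδ₁d hcone hrmin hrmin0 hmove hL hroot hFζ hFΦ hc₀1 hh hFζ0 hFζ1 hFΦ0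
    hFΦ1 hFζa hFΦa B hDn0 hDn
  have hsumB := Finset.sum_le_sum hper
  -- swap the double sum of weights and count the alive nodes per step
  set w : ℕ → ℝ := fun i' ↦ h * (3 * (96 * (4 * Λ + 2) ^ N + 2 * (h / 2 ^ k₀)) *
    (C * FΦ (T + (i' + 1 : ℕ) * h) + 2 * Fζ (T + (i' + 1 : ℕ) * h) / (h / 2 ^ k₀))) with hw
  have hw0 : ∀ i, 0 ≤ w i := fun i ↦ by
    have := hFΦ0 (T + (i + 1 : ℕ) * h); have := hFζ0 (T + (i + 1 : ℕ) * h)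
    have : (0 : ℝ) ≤ 4 * Λ + 2 := by linarith
    simp only [hw]; positivity
  have hswap : ∑ B ∈ 𝒦.powerset, ∑ i' ∈ (range n).filter (fun i ↦ B ∈ F i), w i' ≤ 2 ^ 𝒦.card * ∑ i' ∈ range n, w i' := by
    rw [Finset.sum_comm' (t' := range n) (s' := fun i ↦ 𝒦.powerset.filter fun B ↦ B ∈ F i) (by
      intro B i
      simp only [Finset.mem_filter, Finset.mem_powerset]
      constructor
      · rintro ⟨hB, hi, hBF⟩; exact ⟨⟨hB, hBF⟩, hi⟩
      · rintro ⟨⟨hB, hBF⟩, hi⟩; exact ⟨hB, hi, hBF⟩)]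
    rw [Finset.mul_sum]
    refine Finset.sum_le_sum fun i _ ↦ ?_
    rw [Finset.sum_const, nsmul_eq_mul]
    refine mul_le_mul_of_nonneg_right ?_ (hw0 i)
    have h1 : ((𝒦.powerset.filter fun B ↦ B ∈ F i).card : ℝ) ≤ (𝒦.powerset.card : ℝ) := by
      exact_mod_cast Finset.card_le_card (Finset.filter_subset _ _)
    rw [Finset.card_powerset] at h1
    exact_mod_cast h1
  have hJsum : ∑ B ∈ 𝒦.powerset, (3 * (96 * (4 * Λ + 2) ^ N + 2 * (h / 2 ^ k₀)) * (C * (h / 2 ^ k₀) + 2) * (2 * Dn)) =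
      2 ^ 𝒦.card * (3 * (96 * (4 * Λ + 2) ^ N + 2 * (h / 2 ^ k₀)) * (C * (h / 2 ^ k₀) + 2) * (2 * Dn)) := by
    rw [Finset.sum_const, Finset.card_powerset, nsmul_eq_mul]; push_cast; ring
  rw [Finset.sum_add_distrib, hJsum] at hsumB
  have habs := (Finset.abs_sum_le_sum_abs _ _).trans hsumB
  rw [hid]
  have hfin := abs_le.mp habs
  nlinarith [hfin.1, hswap, hgain, pow_nonneg (by norm_num : (0 : ℝ) ≤ 2) 𝒦.card]

/-- Registered one-line form of `frozen_block_virial`. [folklore] -/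
theorem frozen_block_virial_inequality : open Literature.Geometry.Lorentzian Finset MeasureTheory intervalIntegral in ∀ {N : ℕ} (ξ v : Fin N → ℝ → E3) (M : Fin N → ℝ) (𝒦 : Finset (Fin N)) {κ δ C c₀ Λ h T TL k : ℝ} {k₀ n : ℕ} (ζ rmin Fζ FΦ Fe : ℝ → ℝ) (hNode : ∀ (t R : ℝ) (c : E3) (A : Finset (Fin N)), TL ≤ t → 0 < R → R ≤ c₀ * t → min (rmin t / (2 * (1 + 3 * δ))) (c₀ * t) ≤ R → ‖c‖ ≤ κ ^ 2 * t → (∀ j ∈ A, ‖ξ j t - c‖ ≤ (1 - 2 * δ) * R) → (∀ j ∉ A, (1 + 2 * δ) * R ≤ ‖ξ j t - c‖) → ∀ s' ∈ Set.Icc t (t + δ * R), ‖∑ j ∈ A, (M j * (√(1 - ‖v j s'‖ ^ 2))⁻¹) • v j s' - ∑ j ∈ A, (M j * (√(1 - ‖v j t‖ ^ 2))⁻¹) • v j t‖ ≤ 3 * (C * ((s' - t) * (R ^ (3 / 2 : ℝ))⁻¹) + ζ t + ζ s')) (hC : 0 ≤ C) (hδ : 0 < δ) (hδ1 : δ ≤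 1 / 10) (hΛ : 32 ≤ Λ) (hΛκ : 2 * κ ^ 2 ≤ Λ * ((1 - 2 * δ) * c₀)) (hc₀ : 0 < c₀) (hc₀1 : c₀ ≤ 1) (hh : 0 < h) (hT : 0 < T) (hTL : TL ≤ T) (hhT : h ≤ T) (hδ₁a : h / 2 ^ k₀ ≤ δ / (1 + 3 * δ)) (hδ₁b : h / 2 ^ k₀ * (2 * κ ^ 2) ≤ δ * c₀) (hδ₁c : h / 2 ^ k₀ ≤ 1 / 16) (hδ₁d : h / 2 ^ k₀ * (Λ + 1) ≤ 1 / 4) (hcone : ∀ (m : ℕ) (x : Fin N), ‖ξ x (T + m * h)‖ ≤ κ ^ 2 * (T + m * h)) (hrmin : ∀ (m : ℕ) (x y : Fin N), x ≠ y → rmin (T + m * h) ≤ ‖ξ x (T + m * h) - ξ y (T + m * h)‖) (hrmin0 : ∀ m : ℕ, 0 < rmin (T + m * h)) (hk₀r : ∀ m : ℕ, (2 : ℝ) ^ (k₀ + 1) ≤ rmin (T + m * h)) (hmove : ∀ x (m m' : ℕ), m ≤ m' → ‖ξ x (T + m' * h) - ξ x (T + m * h)‖ ≤ (m' - m) * h)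 (hroot : ∀ m ≤ n, ∃ D G : ℝ, (∀ x ∈ 𝒦, ∀ y ∈ 𝒦, ‖ξ x (T + m * h) - ξ y (T + m * h)‖ ≤ D) ∧ (∀ x ∈ 𝒦, ∀ z ∈ univ \ 𝒦, G ≤ ‖ξ x (T + m * h) - ξ z (T + m * h)‖) ∧ 1 * D < G) (hFζ : ∀ s t : ℝ, T ≤ s → t / 2 ≤ s → ζ s ≤ Fζ t) (hFΦ : ∀ (m : ℕ) (t : ℝ), t / 2 ≤ T + m * h → (((1 + 3 * δ)⁻¹) ^ (3 / 2 : ℝ))⁻¹ * √2 * (√(rmin (T + m * h)))⁻¹ + 2 * κ ^ 2 * (c₀ ^ (3 / 2 : ℝ))⁻¹ * (√(T + m * h))⁻¹ ≤ FΦ t) (hFe : ∀ s t : ℝ, T ≤ s → t / 2 ≤ s → ∀ j, ‖deriv (ξ j) s - v j s‖ ≤ Fe t) (hFe1 : ∀ t, Fe t ≤ 1) (hFζ0 : ∀ t, 0 ≤ Fζ t) (hFζ1 : ∀ t, Fζ t ≤ 1) (hFΦ0 : ∀ t, 0 ≤ FΦ t) (hFΦ1 : ∀ t, FΦ t ≤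 1) (hFζa : Antitone Fζ) (hFΦa : Antitone FΦ) (hM : ∀ i, 0 < M i) (hk : k < 1) (hvk : ∀ i t, ‖v i t‖ ≤ k) (hvc : ∀ i, Continuous (v i)) (hξ : ∀ i, ContDiff ℝ ((⊤ : ℕ∞) : WithTop ℕ∞) (ξ i)) (h𝒦 : 2 ≤ 𝒦.card) {Dn : ℝ} (hDn0 : 0 ≤ Dn) (hDn : ∀ x ∈ 𝒦, ∀ y ∈ 𝒦, ‖ξ x (T + n * h) - ξ y (T + n * h)‖ ≤ Dn), (2 * ∑ i ∈ 𝒦, M i)⁻¹ * (∫ s in T..(T + n * h), ∑ j ∈ 𝒦, ∑ l ∈ 𝒦, M j * M l * ‖v j s - v l s‖ ^ 2) - ∑ i ∈ range n, h * (2 * (√(1 - k ^ 2))⁻¹ * (∑ i ∈ 𝒦, M i) * Fe (T + (i + 1 : ℕ) * h) + 4 * 𝒦.card * (3 * (C * (h / 2 ^ k₀) * FΦ (T + (i + 1 : ℕ) * h) + 2 * Fζ (T + (i + 1 : ℕ) * h)))) - 2 ^ 𝒦.card * (∑ i ∈ range n, h * (3 * (96 * (4 * Λ + 2) ^ N + 2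 * (h / 2 ^ k₀)) * (C * FΦ (T + (i + 1 : ℕ) * h) + 2 * Fζ (T + (i + 1 : ℕ) * h) / (h / 2 ^ k₀))) + 3 * (96 * (4 * Λ + 2) ^ N + 2 * (h / 2 ^ k₀)) * (C * (h / 2 ^ k₀) + 2) * (2 * Dn)) ≤ (∑ j ∈ 𝒦, inner ℝ ((M j * (√(1 - ‖v j (T + n * h)‖ ^ 2))⁻¹) • v j (T + n * h)) (ξ j (T + n * h) - (∑ l ∈ 𝒦, M l)⁻¹ • ∑ l ∈ 𝒦, M l • ξ l (T + n * h))) - (∑ j ∈ 𝒦, inner ℝ ((M j * (√(1 - ‖v j (T)‖ ^ 2))⁻¹) • v j (T)) (ξ j (T) - (∑ l ∈ 𝒦, M l)⁻¹ • ∑ l ∈ 𝒦, M l • ξ l (T))) :=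
  fun ξ v M 𝒦 _ _ _ _ _ _ _ _ _ _ _ ζ rmin Fζ FΦ Fe hNode hC hδ hδ1 hΛ hΛκ hc₀ hc₀1 hh hT hTL hhT hδ₁a hδ₁b hδ₁c hδ₁d hcone hrmin hrmin0 hk₀r hmove hroot hFζ hFΦ hFe hFe1 hFζ0 hFζ1 hFΦ0 hFΦ1 hFζa hFΦa hM hk hvk hvc hξ h𝒦 _ hDn0 hDn ↦
    frozen_block_virial ξ v M 𝒦 ζ rmin Fζ FΦ Fe hNode hC hδ hδ1 hΛ hΛκ hc₀ hc₀1 hh hT hTL hhT hδ₁a hδ₁b hδ₁c hδ₁d hcone hrmin hrmin0 hk₀r hmove hroot hFζ hFΦ hFe hFe1 hFζ0 hFζ1 hFΦ0 hFΦ1 hFζa hFΦa hM hk hvk hvc hξ h𝒦 hDn0 hDn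

end Summit.FinalStateConjecture.FinalStateConjecture.Theorems.SublinearIsFree.Virial

end
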